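import Summits.AtomisticToContinuum.HydrodynamicLimit.Theses.KnudsenRateHorizon
import Summits.AtomisticToContinuum.HydrodynamicLimit.Theorems.KineticWindowGronwall.Negative.ConsequentLoadBearing

/-!
# `EntropyKnudsenRateInBand` (crux stmt-AtomisticToContinuum-17776), negative side: the `t = 0` tie and the
# Euler balance laws are LOAD-BEARING

Refuter vetting unit `refuter-rattack-stmt-AtomisticToContinuum-17776-0` (route KnudsenRateHorizon, 2026-08-17).
The crux X = `Summit.AtomisticToContinuum.HydrodynamicLimit.Theses.KnudsenRateHorizon.EntropyKnudsenRateInBand`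
(packing-guarded Knudsen-rate Yau bound `klDiv (lawAt Φ_N λ_N t ‖ localGibbs a u_t θ_t) ≤ C (N+1)^(2/3)`) survived
one cycle of basic attacks; this file records, kernel-checked, which hypotheses of X any proof must use — the
guarded, rate-carrying twins of the standing disprover's lemmas for the unguarded `o(N)` target
(`KineticWindowGronwallNegative.relEntropyVanishingUntied_false` / `relEntropyVanishingNoPDE_false`):

* `EntropyKnudsenRateInBandUntied` — X with the `t = 0` law-of-large-numbers tie DELETED — is FALSE
  (`entropyKnudsenRateInBand_false_without_tie`): profiles `(1, 0, 1)`, the constant classical solution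
  `(2, 0, 1)` (inside ANY packing band once `2σ³ < η₀`), Alexander's flows; the exponential concentration clause of
  the reference law for `χ ≡ 1`, `δ = 1/2` bounds the measure of the whole space by `C e^{-(N+1)/C} < 1`.
* `EntropyKnudsenRateInBandNoPDE` — X with `IsHardSphereEulerSolution` WEAKENED to joint smoothness + positivity
  (balance laws deleted, tie and guard kept) — is FALSE (`entropyKnudsenRateInBand_false_without_balanceLaws`):
  uniform activity (pinned LLN density `rhoLim ≡ 1`, tree `PolynomialCompressionPDE.lln_rhoLim`), the smooth
  positive fields `(1 + t, 0, 1)` on `[0, 1)` are tied at `t = 0`, stay in the band (`(1+t)σ³ < 2σ³ < η₀`), and have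
  mass `3/2` at `t = 1/2`.

In both cases the witness kills the reference-concentration clause, so the RATE is not even reached: the rate
clause of X can only be attacked through genuinely tied, genuinely Eulerian data (the open problem).
The packing guard itself cannot be dropped by a refuter: without it X is the route's former unguarded target
(stmt-AtomisticToContinuum-12339), dropped — not refuted — at the Statement re-type.
-/

noncomputable section

namespace Summit.AtomisticToContinuum.HydrodynamicLimit.Theorems.EntropyKnudsenRateInBandNegative

open MeasureTheory Filter Set Topology
open scoped ENNReal
open Literature.MathematicalPhysics.KineticTheory Literature.Analysis.FluidPDE
open Literature.Analysis.FunctionSpaces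
open Summit.AtomisticToContinuum.HydrodynamicLimit.Theorems.PolynomialCompressionPDE (Flows flows_nonempty)
open Summit.AtomisticToContinuum.HydrodynamicLimit.Theorems.DenseExcursionUntied (isHardSphereEulerSolution_const)
open Summit.AtomisticToContinuum.HydrodynamicLimit.Theorems.KineticWindowGronwallNegative
  (false_of_expConc_mass_ne ramp ramp_zero isSmoothSpaceTimeOn_ramp rhoLim_uniform_eq_one
    tendstoHydroFieldsAt_congr_slices)

/-- `EntropyKnudsenRateInBand` with the `t = 0` tie
`TendstoHydroFieldsAt (fun N => localGibbsLaw σ a₀ u₀ θ₀ N (Φ N)) Φ ρ u θ 0 →` DELETED (all else verbatim,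
guard and rate included): the Euler solution is then untied from the local Gibbs data. -/
def EntropyKnudsenRateInBandUntied : Prop :=
  ∃ η₀ : ℝ, 0 < η₀ ∧ ∀ (a₀ θ₀ : T3 → ℝ) (u₀ : T3 → V3), Continuous a₀ → Continuous θ₀ → Continuous u₀ →
    (∀ x, 0 < a₀ x) → (∀ x, 0 < θ₀ x) → ∃ σ₀ : ℝ, 0 < σ₀ ∧ ∀ σ : ℝ, 0 < σ → σ < σ₀ →
    ∀ (T : ℝ) (ρ θ : ℝ → T3 → ℝ) (u : ℝ → T3 → V3), IsHardSphereEulerSolution σ T ρ u θ →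
    (∀ t ∈ Set.Ico 0 T, ∀ x, ρ t x * σ ^ 3 < η₀) →
    ∀ Φ : (N : ℕ) → HardSphereFlow (Torus.geometry (Fin 3)) (hsDiameter σ N) (N + 1),
      (∀ N, IsProbabilityMeasure (localGibbsLaw σ a₀ u₀ θ₀ N (Φ N))) ∧
      (∀ t ∈ Set.Ico 0 T, ∃ a : T3 → ℝ,
        (∀ N, IsProbabilityMeasure (localGibbsLaw σ a (u t) (θ t) N (Φ N))) ∧
        (∀ χ : T3 → ℝ, Continuous χ → ∀ δ : ℝ, 0 < δ → ∃ C : ℝ, 0 < C ∧ ∀ N : ℕ,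
          localGibbsLaw σ a (u t) (θ t) N (Φ N)
              {z | δ < |empiricalDensityField z χ - ∫ x, χ x * ρ t x|} ≤
            ENNReal.ofReal (C * Real.exp (-(C⁻¹ * (N + 1)))) ∧
          localGibbsLaw σ a (u t) (θ t) N (Φ N)
              {z | δ < ‖empiricalMomentumField z χ - ∫ x, (χ x * ρ t x) • u t x‖} ≤
            ENNReal.ofReal (C * Real.exp (-(C⁻¹ * (N + 1)))) ∧
          localGibbsLaw σ a (u t) (θ t) N (Φ N)
              {z | δ < |empiricalEnergyField z χ -
                ∫ x, χ x * totalEnergyDensity (ρ t x) (u t x) (θ t x)|} ≤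
            ENNReal.ofReal (C * Real.exp (-(C⁻¹ * (N + 1))))) ∧
        ∃ C : ℝ, ∀ N : ℕ, InformationTheory.klDiv
            ((Φ N).lawAt (localGibbsLaw σ a₀ u₀ θ₀ N (Φ N)) t) (localGibbsLaw σ a (u t) (θ t) N (Φ N)) ≤
          ENNReal.ofReal (C * ((N : ℝ) + 1) ^ (2 / 3 : ℝ)))

/-- A reduced density below the offered threshold, below `1/4`, and with `2σ³ < η₀` (so that densities `≤ 2`
stay inside the packing band). [folklore] -/
theorem exists_sigma_small {σ₀ η₀ : ℝ} (hσ₀ : 0 < σ₀) (hη₀ : 0 < η₀) :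
    ∃ σ : ℝ, 0 < σ ∧ σ < σ₀ ∧ σ < 1 / 2 ∧ 2 * σ ^ 3 < η₀ := by
  refine ⟨min (σ₀ / 2) (min (1 / 4) (η₀ / 4)), lt_min (by positivity) (lt_min (by norm_num) (by positivity)),
    (min_le_left _ _).trans_lt (by linarith), ?_, ?_⟩
  · exact ((min_le_right _ _).trans (min_le_left _ _)).trans_lt (by norm_num)
  · set σ := min (σ₀ / 2) (min (1 / 4) (η₀ / 4)) with hσ
    have h0 : 0 < σ := lt_min (by positivity) (lt_min (by norm_num) (by positivity))
    have h4 : σ ≤ 1 / 4 := (min_le_right _ _).trans (min_le_left _ _)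
    have hη : σ ≤ η₀ / 4 := (min_le_right _ _).trans (min_le_right _ _)
    have hsq : σ ^ 2 ≤ 1 / 16 := by nlinarith
    nlinarith

/-- **The tie is load-bearing: `EntropyKnudsenRateInBandUntied` is FALSE.** Witness: profiles `(1, 0, 1)`; for
the offered `η₀, σ₀` a `σ` with `σ < σ₀`, `σ < 1/2`, `2σ³ < η₀`; the constant classical solution `(2, 0, 1)` on
`[0, 1)` (inside the band); any flow family (Alexander). At `t = 0` the density-concentration clause with `χ ≡ 1`,
`δ = 1/2` bounds the measure of the WHOLE space (`|1 - 2| = 1 > 1/2`) by `C e^{-(N+1)/C} < 1` for large `N`,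
against total mass `1` of the reference law. [folklore] -/
theorem entropyKnudsenRateInBand_false_without_tie : ¬ EntropyKnudsenRateInBandUntied := by
  rintro ⟨η₀, hη₀, h⟩
  obtain ⟨σ₀, hσ₀, H⟩ := h (fun _ => 1) (fun _ => 1) (fun _ => 0) continuous_const continuous_const
    continuous_const (fun _ => one_pos) (fun _ => one_pos)
  obtain ⟨σ, hσ, hσlt, hσ2, hσband⟩ := exists_sigma_small hσ₀ hη₀
  obtain ⟨Φ⟩ := flows_nonempty hσ hσ2
  have hE := isHardSphereEulerSolution_const σ 1 (0 : V3) (by norm_num : (0 : ℝ) < 2) one_pos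
  have hguard : ∀ t ∈ Set.Ico (0 : ℝ) 1, ∀ _x : T3, (2 : ℝ) * σ ^ 3 < η₀ := fun _ _ _ => hσband
  obtain ⟨-, H2⟩ := H σ hσ hσlt 1 (fun _ _ => 2) (fun _ _ => 1) (fun _ _ => 0) hE hguard Φ
  obtain ⟨a, hPa, hconc, -⟩ := H2 0 ⟨le_rfl, one_pos⟩
  obtain ⟨C, hC, hN⟩ := hconc (fun _ => 1) continuous_const (1 / 2) (by norm_num)
  have hmass : ∫ _x : T3, (2 : ℝ) = 2 := by simp
  have hδ : (1 / 2 : ℝ) < |1 - ∫ _x : T3, (2 : ℝ)| := by rw [hmass]; norm_num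
  exact false_of_expConc_mass_ne (r := fun _ => 2) Φ hPa hδ hC fun N => (hN N).1

/-- `EntropyKnudsenRateInBand` with `IsHardSphereEulerSolution σ T ρ u θ` WEAKENED to its regularity-and-positivity
part (joint smoothness of `ρ, u, θ` on `[0,T) × 𝕋³`, `ρ, θ > 0`; the three balance laws deleted; tie, guard and
rate verbatim). -/
def EntropyKnudsenRateInBandNoPDE : Prop :=
  ∃ η₀ : ℝ, 0 < η₀ ∧ ∀ (a₀ θ₀ : T3 → ℝ) (u₀ : T3 → V3), Continuous a₀ → Continuous θ₀ → Continuous u₀ →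
    (∀ x, 0 < a₀ x) → (∀ x, 0 < θ₀ x) → ∃ σ₀ : ℝ, 0 < σ₀ ∧ ∀ σ : ℝ, 0 < σ → σ < σ₀ →
    ∀ (T : ℝ) (ρ θ : ℝ → T3 → ℝ) (u : ℝ → T3 → V3),
      Torus.IsSmoothSpaceTimeOn (Set.Ico 0 T) ρ → Torus.IsSmoothSpaceTimeOn (Set.Ico 0 T) u →
      Torus.IsSmoothSpaceTimeOn (Set.Ico 0 T) θ → (∀ t ∈ Set.Ico 0 T, ∀ x, 0 < ρ t x) →
      (∀ t ∈ Set.Ico 0 T, ∀ x, 0 < θ t x) →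
    (∀ t ∈ Set.Ico 0 T, ∀ x, ρ t x * σ ^ 3 < η₀) →
    ∀ Φ : (N : ℕ) → HardSphereFlow (Torus.geometry (Fin 3)) (hsDiameter σ N) (N + 1),
      (∀ N, IsProbabilityMeasure (localGibbsLaw σ a₀ u₀ θ₀ N (Φ N))) ∧
      (TendstoHydroFieldsAt (fun N => localGibbsLaw σ a₀ u₀ θ₀ N (Φ N)) Φ ρ u θ 0 →
       ∀ t ∈ Set.Ico 0 T, ∃ a : T3 → ℝ,
        (∀ N, IsProbabilityMeasure (localGibbsLaw σ a (u t) (θ t) N (Φ N))) ∧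
        (∀ χ : T3 → ℝ, Continuous χ → ∀ δ : ℝ, 0 < δ → ∃ C : ℝ, 0 < C ∧ ∀ N : ℕ,
          localGibbsLaw σ a (u t) (θ t) N (Φ N)
              {z | δ < |empiricalDensityField z χ - ∫ x, χ x * ρ t x|} ≤
            ENNReal.ofReal (C * Real.exp (-(C⁻¹ * (N + 1)))) ∧
          localGibbsLaw σ a (u t) (θ t) N (Φ N)
              {z | δ < ‖empiricalMomentumField z χ - ∫ x, (χ x * ρ t x) • u t x‖} ≤
            ENNReal.ofReal (C * Real.exp (-(C⁻¹ * (N + 1)))) ∧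
          localGibbsLaw σ a (u t) (θ t) N (Φ N)
              {z | δ < |empiricalEnergyField z χ -
                ∫ x, χ x * totalEnergyDensity (ρ t x) (u t x) (θ t x)|} ≤
            ENNReal.ofReal (C * Real.exp (-(C⁻¹ * (N + 1))))) ∧
        ∃ C : ℝ, ∀ N : ℕ, InformationTheory.klDiv
            ((Φ N).lawAt (localGibbsLaw σ a₀ u₀ θ₀ N (Φ N)) t) (localGibbsLaw σ a (u t) (θ t) N (Φ N)) ≤
          ENNReal.ofReal (C * ((N : ℝ) + 1) ^ (2 / 3 : ℝ)))

/-- **The balance laws are load-bearing: `EntropyKnudsenRateInBandNoPDE` is FALSE.** Witness: profiles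
`(1, 0, 1)`; `σ` below the offered `σ₀`, below the tree's LLN threshold `σ₁`
(`PolynomialCompressionPDE.lln_rhoLim`: pinned density `rhoLim ≡ 1` for the uniform activity) and with `2σ³ < η₀`;
the smooth positive fields `(1 + t, 0, 1)` on `[0, 1)` ARE tied at `t = 0`, stay in the band, and have mass `3/2`
at `t = 1/2`, so no activity `a` gives exponential concentration of the empirical density of `χ ≡ 1`. [folklore] -/
theorem entropyKnudsenRateInBand_false_without_balanceLaws : ¬ EntropyKnudsenRateInBandNoPDE := by
  rintro ⟨η₀, hη₀, h⟩
  obtain ⟨σ₀, hσ₀, H⟩ := h (fun _ => 1) (fun _ => 1) (fun _ => 0) continuous_const continuous_const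
    continuous_const (fun _ => one_pos) (fun _ => one_pos)
  obtain ⟨σ₁, hσ₁, hσ₁h, L⟩ :=
    Summit.AtomisticToContinuum.HydrodynamicLimit.Theorems.PolynomialCompressionPDE.lln_rhoLim
      (a₀ := fun _ : T3 => (1 : ℝ)) (θ₀ := fun _ => (1 : ℝ)) (u₀ := fun _ => (0 : V3))
      continuous_const continuous_const continuous_const (fun _ => one_pos) (fun _ => one_pos)
  obtain ⟨σ, hσ, hσlt', hσ2', hσband⟩ := exists_sigma_small (lt_min hσ₀ hσ₁) hη₀
  have hσlt : σ < σ₀ := hσlt'.trans_le (min_le_left _ _)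
  have hσlt1 : σ < σ₁ := hσlt'.trans_le (min_le_right _ _)
  obtain ⟨Φ⟩ := flows_nonempty hσ hσ2'
  obtain ⟨hsd, -, hL⟩ := L σ hσ hσlt1
  obtain ⟨-, htie⟩ := hL Φ
  have hpos1 : ∀ t ∈ Set.Ico (0 : ℝ) 1, ∀ x : T3, 0 < ramp t x := fun t ht x => by
    simp only [ramp]; linarith [ht.1]
  have hpos2 : ∀ t ∈ Set.Ico (0 : ℝ) 1, ∀ _x : T3, (0 : ℝ) < 1 := fun _ _ _ => one_pos
  have hguard : ∀ t ∈ Set.Ico (0 : ℝ) 1, ∀ x : T3, ramp t x * σ ^ 3 < η₀ := fun t ht x => by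
    have hr : ramp t x < 2 := by simp only [ramp]; linarith [ht.2]
    have hσ3 : 0 < σ ^ 3 := by positivity
    nlinarith
  obtain ⟨-, H2⟩ := H σ hσ hσlt 1 ramp (fun _ _ => 1) (fun _ _ => 0) (isSmoothSpaceTimeOn_ramp _)
    (Torus.isSmoothSpaceTimeOn_of_contDiff contDiff_const _)
    (Torus.isSmoothSpaceTimeOn_of_contDiff contDiff_const _) hpos1 hpos2 hguard Φ
  have htie' : TendstoHydroFieldsAt (fun N => localGibbsLaw σ (fun _ => 1) (fun _ => 0) (fun _ => 1) N (Φ N)) Φ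
      ramp (fun _ _ => 0) (fun _ _ => 1) 0 := by
    refine (tendstoHydroFieldsAt_congr_slices (ρ' := fun _ => rhoLim (profileOf (fun _ : T3 => (1 : ℝ))
      continuous_const (fun _ => one_pos)) σ) (u' := fun _ _ => 0) (θ' := fun _ _ => 1) ?_ rfl rfl).2 htie
    rw [ramp_zero, rhoLim_uniform_eq_one hsd]
  obtain ⟨a, hPa, hconc, -⟩ := H2 htie' (1 / 2) ⟨by norm_num, by norm_num⟩
  obtain ⟨C, hC, hN⟩ := hconc (fun _ => 1) continuous_const (1 / 4) (by norm_num)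
  have hmass : ∫ x : T3, ramp (1 / 2) x = 3 / 2 := by simp [ramp]; norm_num
  have hδ : (1 / 4 : ℝ) < |1 - ∫ x : T3, ramp (1 / 2) x| := by rw [hmass]; norm_num
  exact false_of_expConc_mass_ne Φ hPa hδ hC fun N => (hN N).1

/-- Transfer to the crux: the crux's hypothesis list with the tie deleted, resp. the balance laws deleted, is
refuted above; so any proof of `EntropyKnudsenRateInBand` uses the `t = 0` tie AND integrates (at least) the
continuity equation along the reference solution — it cannot be a statics-only argument. Stated as the
implications "crux-variant → False" for citation by planners. [folklore] -/
theorem loadBearing_summary :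
    (EntropyKnudsenRateInBandUntied → False) ∧ (EntropyKnudsenRateInBandNoPDE → False) :=
  ⟨entropyKnudsenRateInBand_false_without_tie, entropyKnudsenRateInBand_false_without_balanceLaws⟩

end Summit.AtomisticToContinuum.HydrodynamicLimit.Theorems.EntropyKnudsenRateInBandNegative

end
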